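import Mathlib
import Summits.NavierStokesRegularity.NavierStokesRegularity.Theorems.EulerZoomLiouvillePowerGaugeEulerLiouvilleSelfSimilarEndpointShellSpreadPast
import Summits.NavierStokesRegularity.NavierStokesRegularity.Theorems.EulerZoomLiouvillePowerGaugeEulerLiouvilleSelfSimilarEndpointSobolevDecay
import HarnessLib

/-!
# Rung C1 of the crux `EulerZoomLiouville.PowerGaugeEulerLiouville` at the endpoint `ρ = 1/2` (weak class):
# the growth-free shell-lower stratum for members exactly self-similar about `(T, x₀)` on a PAST sub-slab

Route №10 `EulerZoomLiouville` (NavierStokesRegularity), crux E = stmt-NavierStokesRegularity-19832,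
registered open stubs `stub_selfSimilarWeakRest` / `stub_nonSelfSimilarRest`.  The tree's
`EndpointSpread.selfSimilar_half_ae_eq_zero_of_shellLower_past` (`…SelfSimilarEndpointShellSpreadPast`)
kills a member of Seregin's class at `ρ = 1/2` that is exactly self-similar about `(T, x₀)` on a past
sub-slab `(−∞, T₁)` (`T₁ ≤ 0`, `T₁ ≤ T`) whose profile has POINTWISE sublinear growth and shell energies
`≥ c₀ L^{−5+η}` (`η > 0`) along radii beyond every bound.  Here the sublinear clause is dropped and
`η > 5/2` is asked instead — the past twin of `EndpointSobolev.selfSimilar_half_ae_eq_zero_of_shellLower`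
(`…SelfSimilarEndpointSobolevMember`):

* `EndpointSobolev.selfSimilar_half_false_of_shellLower_past` / `…ae_eq_zero_of_shellLower_past` —
  crux hypotheses verbatim at `ρ = 1/2`, past-exact self-similarity about `(T, x₀)`, and
  `c₀ L^{−5+η} ≤ ∫_{L≤|y|<2L}‖V‖²` for some `c₀ > 0`, `η > 5/2` along unbounded radii ⇒ contradiction /
  the member vanishes a.e.

Every profile-side input comes from the past dictionary `Past.profileData_of_past` (weak gradient `G`
with the large-scale `E`-growth `∫_{B_L}|G|²_F ≤ C_E L^{1/2}` for `L ≥ 2 − T₁`, extended to all `L ≥ 1`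
by monotonicity; `V ∈ L²`, `L⁶` on balls, `P ∈ L^{3/2}` on balls, Poisson, energy equality); the velocity
growth of the Riesz identification comes from the weak gradient
(`EndpointSobolev.exists_setIntegral_cube_ball_le`) and the endgame is
`EndpointSobolev.profile_false_half_of_shellLower_of_profileEE_of_weakGradient` (drain rate `5/2`).
The body is the tree's `EndpointSpread.selfSimilar_half_false_of_shellLower_past`, verbatim but for
those two inputs (adapted from `…SelfSimilarEndpointShellSpreadPast`).

WHAT THIS IS NOT: not NS, not E, not the stubs — one past endpoint stratum widened.
[cite: ChaeShvydkoy2013, §3.1 Thm. 3.1; BronziShvydkoy2015, Remark 1.5]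
-/

noncomputable section

-- flat `Theorems/<Route><Decl>…` files of one crux share the namespace of the crux (tree convention)
set_option linter.dupNamespace false

open MeasureTheory Set Filter Topology Metric Function TopologicalSpace
open scoped ENNReal NNReal InnerProductSpace RealInnerProductSpace Laplacian

namespace Summit.NavierStokesRegularity.NavierStokesRegularity.Theorems.PowerGaugeEulerLiouville

open Literature.Analysis Literature.Analysis.FunctionSpaces Literature.Analysis.FluidPDE

namespace EndpointSobolev

open EndpointSpread

section Member

/-- **No past-exact endpoint member whose profile's shell energies are frequently `≥ c₀ L^{−5+η}`,
`η > 5/2` — no growth hypothesis.**  If a member of the class at `ρ = 1/2` is exactly self-similar about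
`(T, x₀)` on `(−∞, T₁)` (`T₁ ≤ 0`, `T₁ ≤ T`) with profile `(V, P)` and, for some `c₀ > 0`, `η > 5/2` and
radii `L` beyond every bound, `c₀ L^{−5+η} ≤ ∫_{L≤|y|<2L} ‖V‖²`, contradiction.
[cite: ChaeShvydkoy2013, §3.1 Thm. 3.1] -/
theorem selfSimilar_half_false_of_shellLower_past
    {T T₁ : ℝ} (hT₁ : T₁ ≤ 0) (hTT₁ : T₁ ≤ T) (x₀ : EuclideanSpace ℝ (Fin 3))
    {u : ℝ → EuclideanSpace ℝ (Fin 3) → EuclideanSpace ℝ (Fin 3)}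
    {p : ℝ → EuclideanSpace ℝ (Fin 3) → ℝ}
    {H : ℝ → EuclideanSpace ℝ (Fin 3) → EuclideanSpace ℝ (Fin 3) →L[ℝ] EuclideanSpace ℝ (Fin 3)}
    {c : ℝ≥0} {V : EuclideanSpace ℝ (Fin 3) → EuclideanSpace ℝ (Fin 3)}
    {P : EuclideanSpace ℝ (Fin 3) → ℝ}
    (hsw : IsSuitableWeakSolutionOn (slab (EuclideanSpace ℝ (Fin 3)) (Iio 0) isOpen_Iio) 0 0 u p)
    (hH : HasWeakSpatialGradientOn (slab (EuclideanSpace ℝ (Fin 3)) (Iio 0) isOpen_Iio) u H)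
    (hgauge : ∀ a : ℝ, 0 < a →
      ENNReal.ofReal (a ^ (2 * (1 / 2 : ℝ))) * cknA a (0 : ℝ × EuclideanSpace ℝ (Fin 3)) u +
          ENNReal.ofReal (a ^ (1 / 2 : ℝ)) * cknE a (0 : ℝ × EuclideanSpace ℝ (Fin 3)) H +
        ENNReal.ofReal (a ^ (2 * (1 / 2 : ℝ))) * cknD a (0 : ℝ × EuclideanSpace ℝ (Fin 3)) p ≤
          (c : ℝ≥0∞))
    (hu : ∀ τ : ℝ, τ < T₁ → u τ = fun x =>
      selfSimilarCollapse (1 / (2 + (1 / 2 : ℝ))) T V τ (x - x₀))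
    (hp : ∀ τ : ℝ, τ < T₁ → p τ = fun x =>
      selfSimilarCollapsePressure (1 / (2 + (1 / 2 : ℝ))) T P τ (x - x₀))
    {c₀ η : ℝ} (hc₀ : 0 < c₀) (hη : 5 / 2 < η)
    (hlow : ∀ L₁ : ℝ, ∃ L : ℝ, L₁ ≤ L ∧
      c₀ * L ^ (-(5 : ℝ) + η) ≤
        ∫ y in {y : EuclideanSpace ℝ (Fin 3) | L ≤ ‖y‖ ∧ ‖y‖ < 2 * L}, ‖V y‖ ^ 2) : False := by
  -- the three gauges separately
  have hA : ∀ a : ℝ, 0 < a → ENNReal.ofReal (a ^ (2 * (1 / 2 : ℝ))) *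
      cknA a (0 : ℝ × EuclideanSpace ℝ (Fin 3)) u ≤ (c : ℝ≥0∞) :=
    fun a ha => le_trans (le_trans le_self_add le_self_add) (hgauge a ha)
  have hE : ∀ a : ℝ, 0 < a → ENNReal.ofReal (a ^ (1 / 2 : ℝ)) *
      cknE a (0 : ℝ × EuclideanSpace ℝ (Fin 3)) H ≤ (c : ℝ≥0∞) :=
    fun a ha => le_trans (le_trans le_add_self le_self_add) (hgauge a ha)
  have hD : ∀ a : ℝ, 0 < a → ENNReal.ofReal (a ^ (2 * (1 / 2 : ℝ))) *
      cknD a (0 : ℝ × EuclideanSpace ℝ (Fin 3)) p ≤ (c : ℝ≥0∞) :=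
    fun a ha => le_trans le_add_self (hgauge a ha)
  -- the past profile data at `ρ = 1/2`
  obtain ⟨G, hVm, hPm, hGm, hW, -, ⟨CA, hCAtop, hA₁⟩, ⟨CE, hCEtop, hE₁⟩, ⟨CD, hCDtop, hD₁⟩, hV6, -,
    hP32, -, -, hPoisson, hEE⟩ :=
    Past.profileData_of_past (ρ := 1 / 2) (by norm_num) (by norm_num) hT₁ hTT₁ x₀
      hsw.distributional hH hA hE hD hu hp
  set L₀ : ℝ := 2 - T₁ with hL₀
  have hL₀2 : 2 ≤ L₀ := by rw [hL₀]; linarith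
  have hL₀0 : 0 < L₀ := by linarith
  -- `V ∈ L²` : the large-scale `A`-growth at the endpoint reads `∫_{B_L}|V|² ≤ CA` for `L ≥ L₀`
  have hV2l : ∫⁻ y, ‖V y‖ₑ ^ 2 ≤ CA := by
    -- adapted from the tree's `lintegral_enorm_sq_profile_le_of_half`
    have hU : (⋃ n : ℕ, ball (0 : EuclideanSpace ℝ (Fin 3)) ((n : ℝ) + L₀)) = univ := by
      refine eq_univ_of_forall fun y => mem_iUnion.2 ?_
      obtain ⟨n, hn⟩ := exists_nat_gt ‖y‖
      exact ⟨n, by rw [mem_ball_zero_iff]; linarith⟩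
    have hdir : Directed (· ⊆ ·) fun n : ℕ => ball (0 : EuclideanSpace ℝ (Fin 3)) ((n : ℝ) + L₀) :=
      Monotone.directed_le fun m n hmn => ball_subset_ball (by
        have : (m : ℝ) ≤ n := Nat.cast_le.2 hmn
        linarith)
    rw [← setLIntegral_univ, ← hU, setLIntegral_iUnion_of_directed _ hdir]
    refine iSup_le fun n => ?_
    have h := hA₁ ((n : ℝ) + L₀) (by rw [hL₀]; linarith [Nat.cast_nonneg (α := ℝ) n])
    refine h.trans (le_of_eq ?_)
    norm_num
  have hV2 : Integrable (fun y => ‖V y‖ ^ 2) volume :=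
    integrable_norm_sq_of_lintegral_lt_top hVm (lt_of_le_of_lt hV2l hCAtop.lt_top)
  -- `V ∈ L³_loc` (from `L⁶` on balls) and `|P||V| ∈ L¹_loc`, `P ∈ L¹_loc` (from `L^{3/2}` on balls)
  have hV3B : ∀ r : ℝ, MemLp V 3 (volume.restrict (ball (0 : EuclideanSpace ℝ (Fin 3)) r)) := by
    intro r
    haveI : IsFiniteMeasure (volume.restrict (ball (0 : EuclideanSpace ℝ (Fin 3)) r)) :=
      isFiniteMeasure_restrict.2 measure_ball_lt_top.ne
    exact (hV6 r).mono_exponent (by norm_num)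
  have hV3 : LocallyIntegrable (fun y => ‖V y‖ ^ 3) volume := by
    intro x
    refine ⟨ball 0 (‖x‖ + 1), isOpen_ball.mem_nhds (by rw [mem_ball, dist_zero_right]; linarith), ?_⟩
    exact (hV3B (‖x‖ + 1)).integrable_norm_pow (by norm_num)
  have hPVB : ∀ r : ℝ, IntegrableOn (fun x => |P x| * ‖V x‖) (ball (0 : EuclideanSpace ℝ (Fin 3)) r) volume := by
    -- adapted from `ProfileEnergy.profile_local_energy_equality` (Hölder `(3/2, 3, 1)`)
    intro r
    haveI : ENNReal.HolderTriple (3 / 2 : ℝ≥0∞) 3 1 := by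
      refine ⟨?_⟩
      rw [ENNReal.inv_div (Or.inr (by norm_num)) (Or.inr (by norm_num)), inv_one]
      have e3 : (3 : ℝ≥0∞)⁻¹ = ((3⁻¹ : ℝ≥0) : ℝ≥0∞) := by rw [ENNReal.coe_inv (by norm_num)]; norm_num
      have e23 : (2 / 3 : ℝ≥0∞) = ((2 / 3 : ℝ≥0) : ℝ≥0∞) := by rw [ENNReal.coe_div (by norm_num)]; norm_num
      rw [e3, e23, ← ENNReal.coe_add, ← ENNReal.coe_one, ENNReal.coe_inj]
      norm_num
    have h1 : MemLp (fun x => |P x|) (3 / 2 : ℝ≥0∞) (volume.restrict (ball (0 : EuclideanSpace ℝ (Fin 3)) r)) :=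
      (hP32 r).abs
    have h2 : MemLp (fun x => ‖V x‖) 3 (volume.restrict (ball (0 : EuclideanSpace ℝ (Fin 3)) r)) :=
      (hV3B r).norm
    have h3 : MemLp (fun x => |P x| * ‖V x‖) 1 (volume.restrict (ball (0 : EuclideanSpace ℝ (Fin 3)) r)) := by
      have := MemLp.mul (p := (3 / 2 : ℝ≥0∞)) (q := 3) (r := 1) h2 h1
      simpa [Pi.mul_def, mul_comm] using this
    exact memLp_one_iff_integrable.1 h3
  have hPV : LocallyIntegrable (fun y => |P y| * ‖V y‖) volume := by
    intro x
    exact ⟨ball 0 (‖x‖ + 1), isOpen_ball.mem_nhds (by rw [mem_ball, dist_zero_right]; linarith),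
      hPVB (‖x‖ + 1)⟩
  have hP1 : LocallyIntegrable P volume := by
    intro x
    refine ⟨ball 0 (‖x‖ + 1), isOpen_ball.mem_nhds (by rw [mem_ball, dist_zero_right]; linarith), ?_⟩
    haveI : IsFiniteMeasure (volume.restrict (ball (0 : EuclideanSpace ℝ (Fin 3)) (‖x‖ + 1))) :=
      isFiniteMeasure_restrict.2 measure_ball_lt_top.ne
    have h32 : (1 : ℝ≥0∞) ≤ 3 / 2 := by
      rw [ENNReal.le_div_iff_mul_le (Or.inl two_ne_zero) (Or.inl ENNReal.ofNat_ne_top)]; norm_num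
    exact (hP32 (‖x‖ + 1)).integrable h32
  -- the growth `∫_{B_L} |P| ≤ AP L^{5/3}` for `L ≥ 1` (large-scale `D`-growth + Hölder, threshold inflated)
  set v₁ : ℝ := volume.real (ball (0 : EuclideanSpace ℝ (Fin 3)) 1) with hv₁
  have hv₁0 : 0 ≤ v₁ := measureReal_nonneg
  set AP : ℝ := (CD * ENNReal.ofReal L₀).toReal ^ (2 / 3 : ℝ) *
    (volume.real (ball (0 : EuclideanSpace ℝ (Fin 3)) L₀)) ^ (1 / 3 : ℝ) * L₀ ^ (5 / 3 : ℝ) +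
    (CD.toReal ^ (2 / 3 : ℝ) * v₁ ^ (1 / 3 : ℝ)) with hAP
  have hAP0 : 0 ≤ AP := by positivity
  have hPg : ∀ L : ℝ, 1 ≤ L → ∫ y in ball (0 : EuclideanSpace ℝ (Fin 3)) L, |P y| ≤ AP * L ^ (3 - (4 / 3 : ℝ)) := by
    intro L hL
    have hL0 : 0 < L := by linarith
    rw [show (3 : ℝ) - 4 / 3 = 5 / 3 by norm_num]
    by_cases hLL₀ : L₀ ≤ L
    · -- large scales: `∫⁻_{B_L} ‖P‖ₑ^{3/2} ≤ CD · L`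
      have hDL : ∫⁻ y in ball (0 : EuclideanSpace ℝ (Fin 3)) L, ‖P y‖ₑ ^ (3 / 2 : ℝ) ≤ CD * ENNReal.ofReal L := by
        refine (hD₁ L hLL₀).trans (le_of_eq ?_)
        norm_num
      have h := setIntegral_abs_le_of_lintegral_rpow hPm (ENNReal.mul_ne_top hCDtop ENNReal.ofReal_ne_top) hDL
      refine h.trans ?_
      have f1 : (CD * ENNReal.ofReal L).toReal = CD.toReal * L := by
        rw [ENNReal.toReal_mul, ENNReal.toReal_ofReal hL0.le]
      have f2 : volume.real (ball (0 : EuclideanSpace ℝ (Fin 3)) L) = L ^ 3 * v₁ := by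
        rw [← Measure.addHaar_real_closedBall_eq_addHaar_real_ball,
          Measure.addHaar_real_closedBall _ _ hL0.le, finrank_euclideanSpace_fin]
      have f3 : (L ^ 3 * v₁) ^ (1 / 3 : ℝ) = L * v₁ ^ (1 / 3 : ℝ) := by
        rw [Real.mul_rpow (by positivity) hv₁0, ← Real.rpow_natCast L 3, ← Real.rpow_mul hL0.le]
        norm_num
      have f4 : (CD.toReal * L) ^ (2 / 3 : ℝ) = CD.toReal ^ (2 / 3 : ℝ) * L ^ (2 / 3 : ℝ) :=
        Real.mul_rpow ENNReal.toReal_nonneg hL0.le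
      have f5 : L ^ (5 / 3 : ℝ) = L ^ (2 / 3 : ℝ) * L := by
        rw [show (5 / 3 : ℝ) = 2 / 3 + 1 by norm_num, Real.rpow_add hL0, Real.rpow_one]
      rw [f1, f2, f3, f4, f5]
      have hle : CD.toReal ^ (2 / 3 : ℝ) * v₁ ^ (1 / 3 : ℝ) ≤ AP := by
        rw [hAP]; exact le_add_of_nonneg_left (by positivity)
      calc CD.toReal ^ (2 / 3 : ℝ) * L ^ (2 / 3 : ℝ) * (L * v₁ ^ (1 / 3 : ℝ))
          = (CD.toReal ^ (2 / 3 : ℝ) * v₁ ^ (1 / 3 : ℝ)) * (L ^ (2 / 3 : ℝ) * L) := by ring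
        _ ≤ AP * (L ^ (2 / 3 : ℝ) * L) := mul_le_mul_of_nonneg_right hle (by positivity)
    · -- small scales `1 ≤ L < L₀`: bound by the value at `L₀`, times `L^{5/3} ≥ 1`
      rw [not_le] at hLL₀
      have hDL₀ : ∫⁻ y in ball (0 : EuclideanSpace ℝ (Fin 3)) L₀, ‖P y‖ₑ ^ (3 / 2 : ℝ) ≤ CD * ENNReal.ofReal L₀ := by
        refine (hD₁ L₀ le_rfl).trans (le_of_eq ?_)
        norm_num
      have h := setIntegral_abs_le_of_lintegral_rpow hPm (ENNReal.mul_ne_top hCDtop ENNReal.ofReal_ne_top) hDL₀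
      have hmono : ∫ y in ball (0 : EuclideanSpace ℝ (Fin 3)) L, |P y| ≤
          ∫ y in ball (0 : EuclideanSpace ℝ (Fin 3)) L₀, |P y| :=
        setIntegral_mono_set ((hP1.integrableOn_isCompact (isCompact_closedBall 0 L₀)).mono_set
          ball_subset_closedBall |>.abs) (Eventually.of_forall fun y => abs_nonneg _)
          (ball_subset_ball hLL₀.le).eventuallyLE
      refine hmono.trans (h.trans ?_)
      have h1 : (1 : ℝ) ≤ L ^ (5 / 3 : ℝ) := Real.one_le_rpow hL (by norm_num)
      calc (CD * ENNReal.ofReal L₀).toReal ^ (2 / 3 : ℝ) *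
            volume.real (ball (0 : EuclideanSpace ℝ (Fin 3)) L₀) ^ (1 / 3 : ℝ)
          = (CD * ENNReal.ofReal L₀).toReal ^ (2 / 3 : ℝ) *
              volume.real (ball (0 : EuclideanSpace ℝ (Fin 3)) L₀) ^ (1 / 3 : ℝ) * 1 := (mul_one _).symm
        _ ≤ (CD * ENNReal.ofReal L₀).toReal ^ (2 / 3 : ℝ) *
              volume.real (ball (0 : EuclideanSpace ℝ (Fin 3)) L₀) ^ (1 / 3 : ℝ) * L₀ ^ (5 / 3 : ℝ) * L ^ (5 / 3 : ℝ) := by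
            rw [mul_assoc _ (L₀ ^ (5 / 3 : ℝ))]
            refine mul_le_mul_of_nonneg_left ?_ (by positivity)
            exact one_le_mul_of_one_le_of_one_le (Real.one_le_rpow (by linarith) (by norm_num)) h1
        _ ≤ AP * L ^ (5 / 3 : ℝ) := by
            refine mul_le_mul_of_nonneg_right ?_ (by positivity)
            rw [hAP]
            exact le_add_of_nonneg_right (by positivity)
  -- the weak-gradient bound on balls for ALL `R ≥ 1` (small scales by monotonicity: `L₀ ≥ 1`)
  set C_G : ℝ := CE.toReal * L₀ ^ (1 / 2 : ℝ) with hC_G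
  have hCG : 0 ≤ C_G := by positivity
  have hGB : ∀ R : ℝ, 1 ≤ R →
      (∫⁻ y in ball (0 : EuclideanSpace ℝ (Fin 3)) R, ENNReal.ofReal (frobeniusNormSq (G y))) ≤
        ENNReal.ofReal (C_G * R ^ (1 / 2 : ℝ)) := by
    intro R hR
    have hR0 : 0 < R := one_pos.trans_le hR
    have hCE : CE = ENNReal.ofReal CE.toReal := (ENNReal.ofReal_toReal hCEtop).symm
    -- at the scale `R' = max R L₀ ≥ L₀`
    set R' : ℝ := max R L₀ with hR'
    have hR'L₀ : L₀ ≤ R' := le_max_right _ _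
    have hRR' : R ≤ R' := le_max_left _ _
    have hR'0 : 0 < R' := hR0.trans_le hRR'
    have h1 : (∫⁻ y in ball (0 : EuclideanSpace ℝ (Fin 3)) R, ENNReal.ofReal (frobeniusNormSq (G y))) ≤
        ∫⁻ y in ball (0 : EuclideanSpace ℝ (Fin 3)) R', ENNReal.ofReal (frobeniusNormSq (G y)) :=
      lintegral_mono_set (ball_subset_ball hRR')
    have h2 := hE₁ R' hR'L₀
    have h3 : R' ^ (1 - (1 / 2 : ℝ)) ≤ L₀ ^ (1 / 2 : ℝ) * R ^ (1 / 2 : ℝ) := by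
      rw [show (1 : ℝ) - 1 / 2 = 1 / 2 by norm_num, ← Real.mul_rpow hL₀0.le hR0.le]
      refine Real.rpow_le_rpow hR'0.le ?_ (by norm_num)
      rcases le_total R L₀ with h | h
      · rw [hR', max_eq_right h]
        exact le_mul_of_one_le_right hL₀0.le hR
      · rw [hR', max_eq_left h]
        exact le_mul_of_one_le_left hR0.le (by linarith)
    calc (∫⁻ y in ball (0 : EuclideanSpace ℝ (Fin 3)) R, ENNReal.ofReal (frobeniusNormSq (G y)))
        ≤ CE * ENNReal.ofReal (R' ^ (1 - (1 / 2 : ℝ))) := h1.trans h2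
      _ ≤ CE * ENNReal.ofReal (L₀ ^ (1 / 2 : ℝ) * R ^ (1 / 2 : ℝ)) := by
          gcongr
      _ = ENNReal.ofReal (C_G * R ^ (1 / 2 : ℝ)) := by
          rw [hCE, ← ENNReal.ofReal_mul ENNReal.toReal_nonneg, hC_G, mul_assoc]
  -- the growth of `∫_{B_L} ‖V‖³` from the weak gradient
  obtain ⟨AV, hAV0, hVg0⟩ := EndpointSobolev.exists_setIntegral_cube_ball_le hW hVm hGm hV2 hCG hGB
  have hPg' : ∀ L : ℝ, 1 ≤ L → ∫ y in ball (0 : EuclideanSpace ℝ (Fin 3)) L, |P y| ≤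
      max AP AV * L ^ (3 - (4 / 3 : ℝ)) := fun L hL =>
    (hPg L hL).trans (mul_le_mul_of_nonneg_right (le_max_left _ _) (by positivity))
  have hVg : ∀ L : ℝ, 1 ≤ L → ∫ y in ball (0 : EuclideanSpace ℝ (Fin 3)) L, ‖V y‖ ^ 3 ≤
      max AP AV * L ^ (3 - (4 / 3 : ℝ)) := fun L hL =>
    (hVg0 L hL).trans (mul_le_mul_of_nonneg_right (le_max_right _ _) (by positivity))
  -- the Riesz representation at every scale
  have hPR : ∀ R : ℝ, 1 ≤ R → ∀ᵐ y ∂volume, ‖y‖ < R / 2 →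
      P y = rieszPressure ((ball (0 : EuclideanSpace ℝ (Fin 3)) R).indicator V) y +
        ∫ z in {z | R ≤ ‖z‖}, pressureKernel (y - z) (V z) :=
    fun R hR => pressure_ae_eq_scaleQ_of_poisson hVm hV2 hV3 hP1 hPoisson (σ := 4 / 3)
      (by norm_num) (by norm_num) (le_max_of_le_left hAP0) hPg' hVg (by linarith)
  -- the lower bound in the rate-`5/2` form
  have hη' : 0 < η - 5 / 2 := by linarith
  have hlow' : ∀ L₁ : ℝ, ∃ L : ℝ, L₁ ≤ L ∧
      c₀ * L ^ (-(5 / 2 : ℝ) + (η - 5 / 2)) ≤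
        ∫ y in {y : EuclideanSpace ℝ (Fin 3) | L ≤ ‖y‖ ∧ ‖y‖ < 2 * L}, ‖V y‖ ^ 2 := by
    intro L₁
    obtain ⟨L, hL, h⟩ := hlow L₁
    exact ⟨L, hL, by rwa [show -(5 / 2 : ℝ) + (η - 5 / 2) = -(5 : ℝ) + η by ring]⟩
  exact EndpointSobolev.profile_false_half_of_shellLower_of_profileEE_of_weakGradient hVm hV2 hV3 hPV
    (by norm_num : (1 / (2 + (1 / 2 : ℝ)) : ℝ) = 2 / 5) hEE hPR hW hGm hCG hGB hc₀ hη' hlow'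

/-- **The growth-free shell-lower stratum for past-exact endpoint members, `Sig`-shaped**: vacuously
trivial. [cite: ChaeShvydkoy2013, §3.1 Thm. 3.1] -/
theorem selfSimilar_half_ae_eq_zero_of_shellLower_past
    {T T₁ : ℝ} (hT₁ : T₁ ≤ 0) (hTT₁ : T₁ ≤ T) (x₀ : EuclideanSpace ℝ (Fin 3))
    {u : ℝ → EuclideanSpace ℝ (Fin 3) → EuclideanSpace ℝ (Fin 3)}
    {p : ℝ → EuclideanSpace ℝ (Fin 3) → ℝ}
    {H : ℝ → EuclideanSpace ℝ (Fin 3) → EuclideanSpace ℝ (Fin 3) →L[ℝ] EuclideanSpace ℝ (Fin 3)}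
    {c : ℝ≥0} {V : EuclideanSpace ℝ (Fin 3) → EuclideanSpace ℝ (Fin 3)}
    {P : EuclideanSpace ℝ (Fin 3) → ℝ}
    (hsw : IsSuitableWeakSolutionOn (slab (EuclideanSpace ℝ (Fin 3)) (Iio 0) isOpen_Iio) 0 0 u p)
    (hH : HasWeakSpatialGradientOn (slab (EuclideanSpace ℝ (Fin 3)) (Iio 0) isOpen_Iio) u H)
    (hgauge : ∀ a : ℝ, 0 < a →
      ENNReal.ofReal (a ^ (2 * (1 / 2 : ℝ))) * cknA a (0 : ℝ × EuclideanSpace ℝ (Fin 3)) u +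
          ENNReal.ofReal (a ^ (1 / 2 : ℝ)) * cknE a (0 : ℝ × EuclideanSpace ℝ (Fin 3)) H +
        ENNReal.ofReal (a ^ (2 * (1 / 2 : ℝ))) * cknD a (0 : ℝ × EuclideanSpace ℝ (Fin 3)) p ≤
          (c : ℝ≥0∞))
    (hu : ∀ τ : ℝ, τ < T₁ → u τ = fun x =>
      selfSimilarCollapse (1 / (2 + (1 / 2 : ℝ))) T V τ (x - x₀))
    (hp : ∀ τ : ℝ, τ < T₁ → p τ = fun x =>
      selfSimilarCollapsePressure (1 / (2 + (1 / 2 : ℝ))) T P τ (x - x₀))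
    {c₀ η : ℝ} (hc₀ : 0 < c₀) (hη : 5 / 2 < η)
    (hlow : ∀ L₁ : ℝ, ∃ L : ℝ, L₁ ≤ L ∧
      c₀ * L ^ (-(5 : ℝ) + η) ≤
        ∫ y in {y : EuclideanSpace ℝ (Fin 3) | L ≤ ‖y‖ ∧ ‖y‖ < 2 * L}, ‖V y‖ ^ 2) :
    uncurry u =ᵐ[volume.restrict (Iio (0 : ℝ) ×ˢ (univ : Set (EuclideanSpace ℝ (Fin 3))))] 0 :=
  (selfSimilar_half_false_of_shellLower_past hT₁ hTT₁ x₀ hsw hH hgauge hu hp hc₀ hη hlow).elim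

end Member

end EndpointSobolev

end Summit.NavierStokesRegularity.NavierStokesRegularity.Theorems.PowerGaugeEulerLiouville
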